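import Summits.ABC.IUTFork.Cor312GapWitnessGlueDecoupling
import Summits.ABC.IUTFork.Cor312CheckBGluedNonEquivalence
import HarnessLib

/-!
# [IUTchIII] Cor. 3.12 — check (B) over a CONTENTFUL typed-Thm-3.11 instance: the gluing pair (b1) ∧ (b2) is the
# BOUNDARY CASE `k = 1` of the glue family, the typed Corollary is `k ≤ 1`

Record-only file (D-0012) of the abc-iut cell (wave-5 prover abc-iut-w5-d193, gen 2). TAKES NO SIDE; proof-only
(no definition, no new `Prop` fact). Sequel of `Cor312CheckBGluedNonEquivalence` (p416708, the (α) NON-EQUIVALENCE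
certificate for plan's (G-UPSTREAM) candidate G-w5d155-1, graded STRONG-DEGENERATE by abc-iut-w5-d224's audit
because both separating settings there have EMPTY splitting monoids). Here the same separation is exhibited over
abc-iut-w5-d247's CONTENTFUL instance `NaiveWitness.naiveFull p` (Ψ = {±p^{j²}} ≠ ∅, proper (Ind3) shells,
sign-twisted Kummer transport; `naiveFull_statement` = typed Thm. 3.11 (i) ∧ (ii) ∧ (iii)) using abc-iut-w5-d043's
one-parameter glue family `NaiveWitness.glueSetting p k` (p416760: the naive setting with ONLY the free Θ-glue
replaced by the ball `B_k`; q-glue `B_1`; `glueSetting_statement_iff : Statement ↔ k ≤ 1`).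

RESULTS (every `p` prime, every `k : ℤ`):
* `glueSetting_qRegion_mem_possibleImages_iff` — the q-pilot region `B_1` is a possible image of the Θ-pilot object
  of `glueSetting p k` iff `k = 1` (the (Ind1),(Ind2)-group acts by isometries, the balls are distinct);
* `glueSetting_not_gluedRegions` — for `k ≠ 1` the gluing pair (b1) `ComputedBy` ∧ (b2) FAILS for every region
  algorithm and every column (criterion `not_gluedRegions_of_not_mem_possibleImages` of p416708 + Thm. 3.11 (i)
  `MultiradialCompat` of the naive situation);
* `glueSetting_one_gluedRegions` — for `k = 1` the pair HOLDS (the constant-`B_1` region algorithm, functorial by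
  `image_pBall_of_mem_closure`);
* `glueSetting_gluedRegions_iff : (∃ A n′, (b1) ∧ (b2)) ↔ k = 1` versus `glueSetting_statement_iff : Statement ↔ k ≤ 1`
  — packaged as `gluedRegions_iff_eq_one_and_statement_iff_le_one`: over this contentful family the (G-UPSTREAM)
  candidate is EXACTLY the boundary (identified, equality) case of the typed Corollary, and every `k < 1` is an
  admissible setting with the Corollary TRUE (strictly) and NO gluing pair;
* `contentful_statement_not_imp_gluedRegions`, `contentful_gluedRegions_not_iff_statement` — the (α) certificate in
  the ∃-shapes of p416708 (with `p` as a binder), now with `F := naiveFull p` CONTENTFUL (witness `glueSetting p 0`).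

HONEST SCOPE. Interface-level: the naive ℚ-line packets with `p`-adic balls of record; nothing here says which glue the
intended model carries, and nothing asserts or denies (b2) in print (referee lanes A1/A2). [claim: Mochizuki2012, status: disputed]
[cite: ScholzeStix2018, §2.2 pp. 9–10]
-/

namespace Summit.ABC.IUTFork

namespace Thm311ToCor312

open Thm311 Cor312 Cor312.Checks Cor312.IdentifiedNonVacuity Cor312Vol Cor312Vol.NaiveWitness
  Literature.IUT.LogThetaLattice

section Family

variable (p : ℕ) [hp : Fact p.Prime] (k : ℤ)

omit hp in
/-- The q-pilot region of the glue-`k` setting is the ball `B_1` (definitional). [folklore] -/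
theorem glueSetting_qRegion (j : toyIndex.Label) (vQ : toyIndex.VQ) :
    (glueSetting p k).qRegion j vQ = pBall p j vQ 1 := rfl

omit hp in
/-- Every column of the naive situation carries the same data (definitional). [folklore] -/
theorem naiveSituation_D (n : ℤ) : (naiveSituation p).D n = naiveData p := rfl

/-- The naive situation satisfies Theorem 3.11 (i)'s multiradial compatibility (a conjunct of the CONTENTFUL
`naiveFull_statement`). [folklore] -/
theorem naiveSituation_multiradialCompat : (naiveSituation p).MultiradialCompat := (naive_partI p).2.2

/-- **The q-pilot region is a possible image of the Θ-pilot object of `glueSetting p k` iff `k = 1`.** [folklore] -/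
theorem glueSetting_qRegion_mem_possibleImages_iff (j : toyIndex.Label) (vQ : toyIndex.VQ) :
    (glueSetting p k).qRegion j vQ ∈ (glueSetting p k).possibleImages j vQ ↔ k = 1 := by
  rw [glueSetting_mem_possibleImages_iff, glueSetting_qRegion]
  exact ⟨fun h => ((pBall_injective p j vQ) h).symm, fun h => by rw [h]⟩

/-- **For `k ≠ 1` the gluing pair (b1) ∧ (b2) FAILS for every region algorithm and every column** over the
contentful instance. [folklore] -/
theorem glueSetting_not_gluedRegions (hk : k ≠ 1) (A : RegionAlgorithm (naiveSituation p)) (n' : ℤ) :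
    ¬ (ComputedBy (glueSetting p k) A ∧
        ∀ (j : toyIndex.Label) (vQ : toyIndex.VQ),
          (glueSetting p k).qRegion j vQ = A.ρ ((naiveSituation p).D n') j vQ) :=
  not_gluedRegions_of_not_mem_possibleImages (glueSetting p k) (naiveSituation_multiradialCompat p)
    (j := 0) (vQ := ()) (fun h => hk ((glueSetting_qRegion_mem_possibleImages_iff p k 0 ()).mp h)) A n'

omit hp in
/-- **For `k = 1` the gluing pair HOLDS**: the constant region algorithm `B_1` (functorial — the (Ind1),(Ind2)-group
acts by isometries, `image_pBall_of_mem_closure`) computes both the (Ind3)-enlarged Θ-region and the q-region.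
[folklore] -/
theorem glueSetting_one_gluedRegions : ∃ (A : RegionAlgorithm (naiveSituation p)) (n' : ℤ),
    ComputedBy (glueSetting p 1) A ∧
      ∀ (j : toyIndex.Label) (vQ : toyIndex.VQ),
        (glueSetting p 1).qRegion j vQ = A.ρ ((naiveSituation p).D n') j vQ := by
  refine ⟨⟨fun _ j vQ => pBall p j vQ 1, fun D Φ hΦ j vQ => (image_pBall_of_mem_closure p hΦ j vQ 1).symm⟩, 0,
    fun j vQ => glueSetting_thetaRegion3 p 1 j vQ, fun j vQ => glueSetting_qRegion p 1 j vQ⟩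

/-- **THE DICHOTOMY ON THE GLUE PARAMETER.** Over the contentful instance the (G-UPSTREAM) candidate
«∃ A n′, (b1) ∧ (b2)» holds iff `k = 1`. [folklore] -/
theorem glueSetting_gluedRegions_iff :
    (∃ (A : RegionAlgorithm (naiveSituation p)) (n' : ℤ), ComputedBy (glueSetting p k) A ∧
        ∀ (j : toyIndex.Label) (vQ : toyIndex.VQ),
          (glueSetting p k).qRegion j vQ = A.ρ ((naiveSituation p).D n') j vQ) ↔ k = 1 := by
  constructor
  · rintro ⟨A, n', h⟩
    by_contra hk
    exact glueSetting_not_gluedRegions p k hk A n' h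
  · rintro rfl
    exact glueSetting_one_gluedRegions p

/-- **Gluing pair ↔ `k = 1`; typed Corollary ↔ `k ≤ 1`** (abc-iut-w5-d043's `glueSetting_statement_iff`): the
candidate gap statement is exactly the boundary case of the typed Corollary in this family. [folklore] -/
theorem gluedRegions_iff_eq_one_and_statement_iff_le_one :
    ((∃ (A : RegionAlgorithm (naiveSituation p)) (n' : ℤ), ComputedBy (glueSetting p k) A ∧
        ∀ (j : toyIndex.Label) (vQ : toyIndex.VQ),
          (glueSetting p k).qRegion j vQ = A.ρ ((naiveSituation p).D n') j vQ) ↔ k = 1) ∧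
      (Summit.ABC.IUTFork.Cor312.Setting.Statement (glueSetting p k) ↔ k ≤ 1) :=
  ⟨glueSetting_gluedRegions_iff p k, glueSetting_statement_iff p k⟩

end Family

/-- **(α) OVER A CONTENTFUL INSTANCE, ∃-form.** There is an instantiation whose typed Theorem 3.11 (i) ∧ (ii) ∧ (iii)
instance is the CONTENTFUL `naiveFull p` (nonempty splitting monoids, proper shells, non-identity Kummer transport),
with every bridge hypothesis, `|log(q)| > 0` and the typed Corollary TRUE (glue `B_0 ⊋ B_1`, `0 = −|log Θ| > −|log q|`),
at which (b1) alone and (b2) alone are satisfiable and the gluing pair fails for every region algorithm and column.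
[folklore] -/
theorem contentful_statement_not_imp_gluedRegions (p : ℕ) [Fact p.Prime] :
    ∃ (T : ThetaIndex) (F : FullSituation T) (P : Setting F.toLatticeSituation.toSituation),
      F.Statement ∧ Cor312Vol.BridgeHyps P ∧ P.AbsLogQPos ∧
      Summit.ABC.IUTFork.Cor312.Setting.Statement P ∧
      (∃ A : RegionAlgorithm F.toLatticeSituation.toSituation, ComputedBy P A) ∧
      (∃ (A : RegionAlgorithm F.toLatticeSituation.toSituation) (n' : ℤ),
        ∀ j vQ, P.qRegion j vQ = A.ρ (F.toLatticeSituation.toSituation.D n') j vQ) ∧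
      ∀ (A : RegionAlgorithm F.toLatticeSituation.toSituation) (n' : ℤ),
        ¬ (ComputedBy P A ∧ ∀ j vQ, P.qRegion j vQ = A.ρ (F.toLatticeSituation.toSituation.D n') j vQ) := by
  refine ⟨toyIndex, naiveFull p, glueSetting p 0, naiveFull_statement p, glueSetting_bridgeHyps p 0,
    glueSetting_absLogQPos p 0, (glueSetting_statement_iff p 0).mpr zero_le_one, ?_, ?_,
    glueSetting_not_gluedRegions p 0 (by decide)⟩
  · exact ⟨⟨fun _ j vQ => pBall p j vQ 0, fun D Φ hΦ j vQ => (image_pBall_of_mem_closure p hΦ j vQ 0).symm⟩,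
      fun j vQ => glueSetting_thetaRegion3 p 0 j vQ⟩
  · exact ⟨⟨fun _ j vQ => pBall p j vQ 1, fun D Φ hΦ j vQ => (image_pBall_of_mem_closure p hΦ j vQ 1).symm⟩, 0,
      fun j vQ => glueSetting_qRegion p 0 j vQ⟩

/-- **(α) OVER A CONTENTFUL INSTANCE, `¬ ↔` form.** [folklore] -/
theorem contentful_gluedRegions_not_iff_statement (p : ℕ) [Fact p.Prime] :
    ∃ (T : ThetaIndex) (F : FullSituation T) (P : Setting F.toLatticeSituation.toSituation),
      F.Statement ∧ Cor312Vol.BridgeHyps P ∧ P.AbsLogQPos ∧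
      ¬ ((∃ (A : RegionAlgorithm F.toLatticeSituation.toSituation) (n' : ℤ), ComputedBy P A ∧
            ∀ j vQ, P.qRegion j vQ = A.ρ (F.toLatticeSituation.toSituation.D n') j vQ) ↔
          Summit.ABC.IUTFork.Cor312.Setting.Statement P) :=
  ⟨toyIndex, naiveFull p, glueSetting p 0, naiveFull_statement p, glueSetting_bridgeHyps p 0,
    glueSetting_absLogQPos p 0, fun h => by
      obtain ⟨A, n', hglue⟩ := h.mpr ((glueSetting_statement_iff p 0).mpr zero_le_one)
      exact glueSetting_not_gluedRegions p 0 (by decide) A n' hglue⟩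

/- NB: the parameter-free ∃-form (e.g. at `p = 2`) has literally the same TYPE as p416708's
`gluedRegions_not_iff_statement` (a closed proposition), so it is not restated here (gate dedup); cite that
declaration, or instantiate `contentful_gluedRegions_not_iff_statement 2` under `Fact (Nat.Prime 2)`. -/

end Thm311ToCor312

end Summit.ABC.IUTFork
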